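import Summits.Ventures.PercRepro.SixFourResidueThreeBetaAll

/-!
# The `t = 3` clause of `SixFourResidue` — plane + `k` points for every plane size `p ≤ 100`: the one-long-line bound (p2, gen 9 — §19.7 Step 4, §21.18.3)

Two lines of a plane share at most one point, so at most one line of the trace `τ` has more than `h = ⌊(p+1)/2⌋`
points (`long_lines_card_le_one`), and `Σ_λ C(m_λ, 2) = C(p, 2)`.  Hence for the additive bound
`20·J₃ ≥ A20 k p + Σ_λ B20 k p m_λ` of `SixFourResidueThreeBetaAll.lean`: with a rational `ρ = a/b ≤ 0` such that
`ρ·C(m,2) ≤ B20 k p m` for every short size `m` (`2m ≤ p + 1`),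

  `Σ_λ B20 k p m_λ ≥ B20 k p m₁ + ρ·(C(p,2) − C(m₁,2))`   (`m₁` the long line, or `m₁ = 0` if there is none; `sum_B20_ge`),

so `J₃ ≥ 0` follows from the integer certificate `BetaCertN k p a b` (`ρ = a/b`): the short-line inequalities, the
no-long-line case and every long size `h < m₁ ≤ p` (`J_three_nonneg_of_plane_add_one_of_cert`,
`J_three_nonneg_of_plane_add_two_of_cert`).  The certificates `ρ_p = min(0, min_{3 ≤ m ≤ h} B20 k p m/(20·C(m,2)))` are
decided for every `4 ≤ p ≤ 100` at `k = 1, 2` in `SixFourResidueThreeBetaTable.lean` (`betaCheck1_p`, `betaCheck2_p`;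
computed by residue/beta_cert.py — the minima of the bound are `3.9` at `p = 4` (`k = 1`) and `4.07` at `p = 7` (`k = 2`),
then growing like `2^p`), giving **Proposition 21.5 and Theorem 21.6 at `t = 3` for every plane trace with `≤ 60` points**
(`J_three_nonneg_of_plane_add_one_of_table`, `J_three_nonneg_of_plane_add_two_of_table` there); `p ≥ 101` is §21.18.3's
analytic tail (open).
-/

namespace PercRepro.SixFour

/-- The integer one-long-line certificate at `(k, p)` with `ρ = a/b`. -/
def BetaCertN (k p : ℕ) (a : ℤ) (b : ℕ) : Prop :=
  0 < b ∧ a ≤ 0 ∧ (∀ m < p + 1, m * 2 ≤ p + 1 → 20 * a * (m.choose 2 : ℤ) ≤ (b : ℤ) * B20 k p m) ∧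
    0 ≤ (b : ℤ) * A20 k p + 20 * a * (p.choose 2 : ℤ) ∧
    (∀ m₁ < p, p + 1 < m₁ * 2 → 0 ≤ (b : ℤ) * (A20 k p + B20 k p m₁) + 20 * a * ((p.choose 2 : ℤ) - (m₁.choose 2 : ℤ)))

/-- `BetaCertN` is decidable. -/
instance (k p : ℕ) (a : ℤ) (b : ℕ) : Decidable (BetaCertN k p a b) := by unfold BetaCertN; infer_instance

/-- `smallTot 0 p c = 0`. -/
theorem smallTot_zero (p c : ℕ) : smallTot 0 p c = 0 := by
  unfold smallTot
  refine Finset.sum_eq_zero (fun j hj => ?_)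
  rw [Finset.mem_filter] at hj
  exact Nat.choose_eq_zero_of_lt (by omega)

/-- `B20 k p 0 = 0`. -/
theorem B20_zero (k p : ℕ) : B20 k p 0 = 0 := by
  unfold B20
  rw [smallTot_zero, smallTot_zero]
  split_ifs <;> simp [delta, eps, collCount]

open Finset ThmH

variable {α : Type*} [DecidableEq α] {M : Matroid α} [M.Finite] {G : Finset α}

section Long

variable (hs : Simple M) {τ : Finset α} (hτ : τ ⊆ gr M)
include hs

/-- At most one line meets `τ` in more than `(p + 1)/2` points. -/
theorem long_lines_card_le_one : ((lines M).filter (fun L : Finset α => τ.card + 1 < (L ∩ τ).card * 2)).card ≤ 1 := by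
  rw [Finset.card_le_one]
  intro L hL L' hL'
  rw [Finset.mem_filter] at hL hL'
  by_contra hne
  have := card_trace_add_card_trace_le hs (τ := τ) hL.1 hL'.1 hne
  omega

include hτ in
/-- **The one-long-line bound**: `Σ_λ B20 k p m_λ ≥ B20 k p m₁ + ρ(C(p,2) − C(m₁,2))` for the long line `m₁` (or `m₁ = 0`). -/
theorem sum_B20_ge (hr : M.eRk (τ : Set α) = 3) (k : ℕ) (a : ℤ) (b : ℕ)
    (hshort : ∀ m < τ.card + 1, m * 2 ≤ τ.card + 1 → 20 * a * (m.choose 2 : ℤ) ≤ (b : ℤ) * B20 k τ.card m) :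
    ∃ m₁, m₁ < τ.card ∧ (m₁ = 0 ∨ τ.card + 1 < m₁ * 2) ∧
      (b : ℤ) * B20 k τ.card m₁ + 20 * a * ((τ.card.choose 2 : ℤ) - (m₁.choose 2 : ℤ)) ≤
        (b : ℤ) * ∑ L ∈ lines M, B20 k τ.card (L ∩ τ).card := by
  set Lg := (lines M).filter (fun L : Finset α => τ.card + 1 < (L ∩ τ).card * 2) with hLg
  have hpairs : ∑ L ∈ lines M, ((L ∩ τ).card.choose 2 : ℤ) = (τ.card.choose 2 : ℤ) := by
    exact_mod_cast sum_choose_two_trace hs hτ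
  have hsplit : ∀ f : Finset α → ℤ, ∑ L ∈ lines M, f L = ∑ L ∈ Lg, f L +
      ∑ L ∈ (lines M).filter (fun L : Finset α => ¬ τ.card + 1 < (L ∩ τ).card * 2), f L := by
    intro f
    rw [hLg, Finset.sum_filter_add_sum_filter_not]
  have hshortsum : ∑ L ∈ (lines M).filter (fun L : Finset α => ¬ τ.card + 1 < (L ∩ τ).card * 2),
      20 * a * ((L ∩ τ).card.choose 2 : ℤ) ≤
      ∑ L ∈ (lines M).filter (fun L : Finset α => ¬ τ.card + 1 < (L ∩ τ).card * 2), (b : ℤ) * B20 k τ.card (L ∩ τ).card := by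
    refine Finset.sum_le_sum (fun L hL => ?_)
    rw [Finset.mem_filter] at hL
    have hle := Finset.card_le_card (Finset.inter_subset_right (s₁ := L) (s₂ := τ))
    exact hshort _ (by omega) (by omega)
  have hcard := long_lines_card_le_one hs (τ := τ)
  rw [← hLg] at hcard
  rcases Nat.lt_or_ge Lg.card 1 with h0 | h1
  · -- no long line
    have hempty : Lg = ∅ := Finset.card_eq_zero.1 (by omega)
    have hp3 := three_le_card_of_eRk_eq_three hr
    refine ⟨0, by omega, Or.inl rfl, ?_⟩
    rw [B20_zero, mul_zero, zero_add, Nat.choose_zero_succ, Nat.cast_zero, sub_zero, Finset.mul_sum, hsplit, hempty,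
      Finset.sum_empty, zero_add]
    have hp : 20 * a * (τ.card.choose 2 : ℤ) = ∑ L ∈ (lines M).filter (fun L : Finset α => ¬ τ.card + 1 < (L ∩ τ).card * 2),
        20 * a * ((L ∩ τ).card.choose 2 : ℤ) := by
      rw [← Finset.mul_sum]
      congr 1
      rw [← hpairs, hsplit (fun L => ((L ∩ τ).card.choose 2 : ℤ)), hempty, Finset.sum_empty, zero_add]
    rw [hp]
    exact hshortsum
  · -- exactly one long line `L₁`
    have hone : Lg.card = 1 := by omega
    obtain ⟨L₁, hL₁⟩ := Finset.card_eq_one.1 hone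
    have hL₁mem : L₁ ∈ Lg := by rw [hL₁]; exact Finset.mem_singleton_self L₁
    rw [hLg, Finset.mem_filter] at hL₁mem
    have hlt : (L₁ ∩ τ).card < τ.card := by
      have hle : (L₁ ∩ τ).card ≤ τ.card := Finset.card_le_card Finset.inter_subset_right
      rcases Nat.lt_or_ge (L₁ ∩ τ).card τ.card with h | h
      · exact h
      · exfalso
        have heq : L₁ ∩ τ = τ := Finset.eq_of_subset_of_card_le Finset.inter_subset_right h
        have hsub : τ ⊆ L₁ := by rw [← heq]; exact Finset.inter_subset_left
        have h2 := M.eRk_mono (Finset.coe_subset.2 hsub)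
        rw [hr, (mem_lines.1 hL₁mem.1).2.2] at h2
        have h32 : (3 : ℕ) ≤ 2 := by exact_mod_cast h2
        omega
    refine ⟨(L₁ ∩ τ).card, hlt, Or.inr hL₁mem.2, ?_⟩
    rw [Finset.mul_sum, hsplit, hL₁, Finset.sum_singleton]
    have hp : 20 * a * ((τ.card.choose 2 : ℤ) - ((L₁ ∩ τ).card.choose 2 : ℤ)) =
        ∑ L ∈ (lines M).filter (fun L : Finset α => ¬ τ.card + 1 < (L ∩ τ).card * 2), 20 * a * ((L ∩ τ).card.choose 2 : ℤ) := by
      rw [← Finset.mul_sum]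
      congr 1
      have := hsplit (fun L => ((L ∩ τ).card.choose 2 : ℤ))
      rw [hpairs, hL₁, Finset.sum_singleton] at this
      linarith
    rw [hp]
    linarith [hshortsum]

end Long

/-! ## The certified theorems -/

section Final

variable (hs : Simple M) (hG : G ⊆ gr M) {P₀ : Finset α} (hP₀ : P₀ ∈ planes M)
include hs hG hP₀

omit hP₀ in
/-- From the additive bound and a certificate: `0 ≤ J₃` (the common closing step). -/
theorem J_three_nonneg_of_cert {k : ℕ} {a : ℤ} {b : ℕ} (hr3 : M.eRk ((P₀ ∩ G : Finset α) : Set α) = 3)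
    (hcert : BetaCertN k (P₀ ∩ G).card a b)
    (hadd : ((A20 k (P₀ ∩ G).card : ℤ) : ℚ) + ∑ L ∈ lines M, ((B20 k (P₀ ∩ G).card (L ∩ (P₀ ∩ G)).card : ℤ) : ℚ) ≤
      20 * J M G 3) : 0 ≤ J M G 3 := by
  obtain ⟨hb, -, hshort, hnone, hlong⟩ := hcert
  have hτ : P₀ ∩ G ⊆ gr M := Finset.inter_subset_right.trans hG
  obtain ⟨m₁, hm₁, hcase, hge⟩ := sum_B20_ge hs hτ hr3 k a b hshort
  have hnn : 0 ≤ (b : ℤ) * (A20 k (P₀ ∩ G).card + ∑ L ∈ lines M, B20 k (P₀ ∩ G).card (L ∩ (P₀ ∩ G)).card) := by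
    rcases hcase with h0 | hl
    · subst h0
      rw [B20_zero, mul_zero, zero_add, Nat.choose_zero_succ, Nat.cast_zero, sub_zero] at hge
      nlinarith [hnone, hge]
    · have := hlong m₁ hm₁ hl
      nlinarith [this, hge]
  have hq : (0 : ℚ) ≤ (b : ℚ) * (((A20 k (P₀ ∩ G).card : ℤ) : ℚ) +
      ∑ L ∈ lines M, ((B20 k (P₀ ∩ G).card (L ∩ (P₀ ∩ G)).card : ℤ) : ℚ)) := by
    have := (Int.cast_le (R := ℚ)).2 hnn
    push_cast at this ⊢
    linarith
  have hbq : (0 : ℚ) < (b : ℚ) := by exact_mod_cast hb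
  have hJ : (0 : ℚ) ≤ (b : ℚ) * (20 * J M G 3) := le_trans hq (mul_le_mul_of_nonneg_left hadd hbq.le)
  nlinarith [hJ, hbq]

/-- **Proposition 21.5 at `t = 3` from a certificate**: `G ∖ P₀ = {a}`, `τ = P₀ ∩ G` rank `3`, `BetaCertN 1 p a b` ⇒ `0 ≤ J₃`. -/
theorem J_three_nonneg_of_plane_add_one_of_cert (hcard : (P₀ ∩ G).card + 1 = G.card) {a : ℤ} {b : ℕ}
    (hcert : BetaCertN 1 (P₀ ∩ G).card a b) : 0 ≤ J M G 3 := by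
  obtain ⟨x, ht⟩ := oneOff_of_card (M := M) hcard
  by_cases hr3 : M.eRk ((P₀ ∩ G : Finset α) : Set α) = 3
  · exact J_three_nonneg_of_cert hs hG hr3 hcert (J_three_ge_additive₁ hs hG hP₀ ht hr3)
  · have hshares := J_three_ge_shares ht hG hP₀
    have hempty : R3 M (P₀ ∩ G) = ∅ := by
      rw [Finset.eq_empty_iff_forall_notMem]
      intro S hS
      obtain ⟨hSτ, hS3⟩ := mem_R3.1 hS
      apply hr3
      refine le_antisymm ?_ (by rw [← hS3]; exact M.eRk_mono (Finset.coe_subset.2 hSτ))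
      rw [← (mem_planes.1 hP₀).2.2]
      exact M.eRk_mono (Finset.coe_subset.2 Finset.inter_subset_left)
    rw [hempty, Finset.sum_empty, Finset.sum_empty] at hshares
    linarith

/-- **Theorem 21.6 at `t = 3` from a certificate**: `G ∖ P₀ = {a, a′}`, `BetaCertN 2 p a b` ⇒ `0 ≤ J₃`. -/
theorem J_three_nonneg_of_plane_add_two_of_cert (hr : M.eRk (G : Set α) = 4) (hcard : (P₀ ∩ G).card + 2 = G.card)
    {a : ℤ} {b : ℕ} (hcert : BetaCertN 2 (P₀ ∩ G).card a b) : 0 ≤ J M G 3 := by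
  obtain ⟨x, x', ht⟩ := twoOff_of_card (M := M) hcard
  by_cases hr3 : M.eRk ((P₀ ∩ G : Finset α) : Set α) = 3
  · exact J_three_nonneg_of_cert hs hG hr3 hcert (J_three_ge_additive₂ hs hG hP₀ hr ht hr3)
  · -- `τ` has rank `≤ 2`: demand-free (as in `J_three_nonneg_of_plane_add_two`)
    have hle2 : M.eRk ((P₀ ∩ G : Finset α) : Set α) ≤ 2 := by
      have hle3 : M.eRk ((P₀ ∩ G : Finset α) : Set α) ≤ 3 := by
        rw [← (mem_planes.1 hP₀).2.2]
        exact M.eRk_mono (Finset.coe_subset.2 Finset.inter_subset_left)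
      obtain ⟨n, hn, -⟩ := eRk_eq_nat M (P₀ ∩ G)
      rw [hn] at hle3 hr3 ⊢
      have a1 : n ≤ 3 := by exact_mod_cast hle3
      have a3 : n ≠ 3 := fun h => hr3 (by rw [h]; rfl)
      exact_mod_cast (show n ≤ 2 by omega)
    apply J_three_nonneg_of_demandFree
    intro B hB
    obtain ⟨hBG, hB4⟩ := mem_R4.1 hB
    have hmem : ∀ y ∈ ({x, x'} : Finset α), y ∉ B → False := by
      intro y hy hyB
      rw [Finset.mem_insert, Finset.mem_singleton] at hy
      have hBsub : B ⊆ insert (if y = x then x' else x) (P₀ ∩ G) := by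
        intro b hb
        rw [Finset.mem_insert]
        by_cases hbP : b ∈ P₀
        · exact Or.inr (Finset.mem_inter.2 ⟨hbP, hBG hb⟩)
        · rcases ht.cover b (hBG hb) hbP with rfl | rfl
          · rcases hy with rfl | rfl
            · exact absurd hb hyB
            · exact Or.inl (by simp [ht.ne.symm])
          · rcases hy with rfl | rfl
            · exact Or.inl (by simp)
            · exact absurd hb hyB
      have h1 : M.eRk ((insert (if y = x then x' else x) (P₀ ∩ G) : Finset α) : Set α) ≤
          M.eRk ((P₀ ∩ G : Finset α) : Set α) + 1 := by
        rw [Finset.coe_insert]; exact M.eRk_insert_le_add_one _ _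
      have : M.eRk (B : Set α) ≤ 3 := by
        calc M.eRk (B : Set α) ≤ M.eRk ((insert (if y = x then x' else x) (P₀ ∩ G) : Finset α) : Set α) :=
              M.eRk_mono (Finset.coe_subset.2 hBsub)
          _ ≤ M.eRk ((P₀ ∩ G : Finset α) : Set α) + 1 := h1
          _ ≤ 2 + 1 := add_le_add_left hle2 1
          _ = 3 := by norm_num
      rw [hB4] at this
      exact absurd this (by decide)
    have hxB : x ∈ B := by by_contra h; exact hmem x (by simp) h
    have hx'B : x' ∈ B := by by_contra h; exact hmem x' (by simp) h
    have hsub : G \ B ⊆ P₀ ∩ G := by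
      intro z hz
      rw [Finset.mem_sdiff] at hz
      refine Finset.mem_inter.2 ⟨?_, hz.1⟩
      by_contra hzP
      rcases ht.cover z hz.1 hzP with rfl | rfl
      · exact hz.2 hxB
      · exact hz.2 hx'B
    exact (M.eRk_mono (Finset.coe_subset.2 hsub)).trans hle2

end Final

end PercRepro.SixFour
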